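import Mathlib
import HarnessLib
import Summits.NavierStokesRegularity.NavierStokesRegularity.Theorems.PoloidalWindowDoorPoloidalWindowRigidityThmA
import Summits.NavierStokesRegularity.NavierStokesRegularity.Theorems.PoloidalWindowDoorPoloidalWindowRigidityThmASliceGeometry
import Summits.NavierStokesRegularity.NavierStokesRegularity.Theorems.PoloidalWindowDoorPoloidalWindowRigidityTimeHeightShearLinearSlice
import Summits.NavierStokesRegularity.NavierStokesRegularity.Theorems.PoloidalWindowDoorPoloidalWindowRigidityClassSpaceTimeRates

/-!
# Theorem A, class form: a (TH) window with one non-degenerate point on a semi-elliptic slice does not exist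

Seat ns-poloidal-K2-p2 g6 (interim lead-of-record on crux K2 `PoloidalWindowRigidity` = stmt-NavierStokesRegularity-19708;
line `mixed_type` v1; item stmt-20428 `LrcModEntire`).  THE CLASS COROLLARY of Theorem A
(`…ThmA.fderiv_eq_zero_of_sliceEquation`):

* `not_timeHeightShear_semiElliptic` — for a profile `v` of the route's Type-I class (Type-I rate, continuous on the slab,
  unit-viscosity Oseen-mild, divergence-free slices — poloidality is NOT used), a nonempty open `W` in the backward slab on
  which the shear slope is a function of time and height ((TH): `∂₂v_b = m(t, y₂) ∂_b v₂`, `b = 0,1`), a point `z₀ ∈ W`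
  with `∇ₕv₂(z₀) ≠ 0` and `∂₂vₕ(z₀) ≠ 0`, and the SEMI-ELLIPTIC sign `∂₂v₀·∂₀v₂ + ∂₂v₁·∂₁v₂ ≥ 0` at every point of the
  slice `t = z₀.1` — CONTRADICTION.

Proof.  On the slice `s = z₀.1`, `…TimeHeightShearLinearSlice.linearSlice_of_timeHeightShear` makes every horizontal plane
flat or proportional-shear with one slope `μ(c)` and `∂₂²v₂ = −μ(c) Δₕ v₂` on it; the flat heights are nowhere dense
(else `∇ₕv₂ ≡ 0` by analyticity, against `z₀`); the semi-elliptic sign gives `μ ≥ 0` on non-flat planes and `μ > 0` at the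
height of `z₀`.  Theorem A, applied on `ℝ³` to `w(z, y) = v₂(s, P y + z e₂)` (`…ThmASliceGeometry`; class bounds from
`…ClassSpaceTimeRates.exists_iteratedFDeriv_rate_of_class`), gives `∇ₕ v₂(s, ·) ≡ 0` — against `z₀`.

* `stub_semiElliptic_of_TH` — the `mixed_type` stub `stub_semiElliptic` (crux dir `Lines/mixed_type.lean` v1) with the
  extra (TH) hypothesis, VERBATIM otherwise: the (TH) part of the semi-elliptic stratum is EMPTY; what remains of
  `stub_semiElliptic` is the THICK stratum.
WHAT THIS IS NOT: not a proof of K2 and not a claim about Navier–Stokes regularity — the semi-elliptic half of the (TH)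
column of crux 19708 / item 20428 (bears_on LADDER-NS N0).
-/

-- the summit and its single sub-problem share the name (CONVENTIONS §1)
set_option linter.dupNamespace false

noncomputable section

namespace Summit.NavierStokesRegularity.NavierStokesRegularity.Theorems.PoloidalWindowDoorPoloidalWindowRigidityThmAClass

open Set Function Filter Topology InnerProductSpace Metric
open scoped RealInnerProductSpace ContDiff
open Literature.Analysis Literature.Analysis.FluidPDE
open Summit.NavierStokesRegularity.NavierStokesRegularity.Theorems.PoloidalWindowDoorPoloidalWindowRigidityThmA
open Summit.NavierStokesRegularity.NavierStokesRegularity.Theorems.PoloidalWindowDoorPoloidalWindowRigidityThmASliceGeometry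
open Summit.NavierStokesRegularity.NavierStokesRegularity.Theorems.PoloidalWindowDoorPoloidalWindowRigidityTimeHeightShearLinearSlice
open Summit.NavierStokesRegularity.NavierStokesRegularity.Theorems.PoloidalWindowDoorPoloidalWindowRigidityClassSpaceTimeRates
open Summit.NavierStokesRegularity.NavierStokesRegularity.Theorems.PoloidalWindowDoorPoloidalWindowRigidityClebsch
open Summit.NavierStokesRegularity.NavierStokesRegularity.Theorems.PoloidalWindowDoorPoloidalWindowRigidityConstantShearMeans
open Summit.NavierStokesRegularity.NavierStokesRegularity.Theorems.LocalSineTubeDoorProfileAlignedWindowRigidityAncient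

variable {C : ℝ} {v : ℝ → EuclideanSpace ℝ (Fin 3) → EuclideanSpace ℝ (Fin 3)}

/-! ### Small coordinate facts -/

/-- `‖Dᵏ u₂‖ ≤ ‖Dᵏ u‖`. -/
theorem norm_iteratedFDeriv_coord_le {u : EuclideanSpace ℝ (Fin 3) → EuclideanSpace ℝ (Fin 3)} {n : WithTop ℕ∞}
    (hu : ContDiff ℝ n u) (i : Fin 3) {k : ℕ} (hk : (k : WithTop ℕ∞) ≤ n) (y : EuclideanSpace ℝ (Fin 3)) :
    ‖iteratedFDeriv ℝ k (fun y => u y i) y‖ ≤ ‖iteratedFDeriv ℝ k u y‖ := by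
  have h := (EuclideanSpace.proj (𝕜 := ℝ) i).norm_iteratedFDeriv_comp_left (f := u) (x := y) (hu.contDiffAt) hk
  have hproj : ‖(EuclideanSpace.proj i : EuclideanSpace ℝ (Fin 3) →L[ℝ] ℝ)‖ ≤ 1 :=
    ContinuousLinearMap.opNorm_le_bound _ zero_le_one fun x => by rw [one_mul]; exact PiLp.norm_apply_le x i
  exact h.trans (mul_le_of_le_one_left (norm_nonneg _) hproj)

/-- `|D²g(x)(a, a')| ≤ ‖D(Dg)(x)‖` for unit coordinate vectors. -/
theorem abs_fderiv_fderiv_apply_le {g : EuclideanSpace ℝ (Fin 3) → ℝ} (hg : ContDiff ℝ 2 g)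
    (x : EuclideanSpace ℝ (Fin 3)) (a a' : Fin 3) :
    |fderiv ℝ (fun y => fderiv ℝ g y (EuclideanSpace.single a (1 : ℝ))) x (EuclideanSpace.single a' (1 : ℝ))| ≤
      ‖fderiv ℝ (fderiv ℝ g) x‖ := by
  have hd : DifferentiableAt ℝ (fderiv ℝ g) x :=
    (hg.fderiv_right (m := 1) (by norm_num)).differentiable one_ne_zero x
  rw [fderiv_clm_apply hd (differentiableAt_const _)]
  simp only [fderiv_fun_const, Pi.zero_apply, ContinuousLinearMap.comp_zero, zero_add, ContinuousLinearMap.flip_apply]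
  rw [← Real.norm_eq_abs]
  refine (ContinuousLinearMap.le_opNorm _ _).trans ?_
  refine (mul_le_mul_of_nonneg_right (ContinuousLinearMap.le_opNorm _ _) (norm_nonneg _)).trans ?_
  simp

/-! ### The class corollary -/

/-- **THEOREM A, CLASS FORM: (TH) + one non-degenerate point + a semi-elliptic slice ⇒ contradiction.**  See the file
header. [folklore] -/
theorem not_timeHeightShear_semiElliptic (hrate : HasTypeITimeDecay C v)
    (hcont : ContinuousOn (uncurry v) (Iio (0 : ℝ) ×ˢ univ))
    (hmild : ∀ s t : ℝ, s < t → t < 0 → ∀ x,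
      v t x = UnboundedOperators.heatExtension (v s) (t - s) x - oseenDuhamel 1 s v v t x)
    (hdiv : ∀ t < 0, VectorCalculus.IsDivFree (v t))
    {W : Set (ℝ × EuclideanSpace ℝ (Fin 3))} (hW : IsOpen W) (hWne : W.Nonempty) (hWs : W ⊆ Iio (0 : ℝ) ×ˢ univ)
    {m : ℝ → ℝ → ℝ}
    (hTH : ∀ z ∈ W, ∀ b : Fin 3, b ≠ 2 →
      fderiv ℝ (v z.1) z.2 (EuclideanSpace.single 2 1) b =
        m z.1 (z.2 2) * fderiv ℝ (v z.1) z.2 (EuclideanSpace.single b 1) 2)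
    {z₀ : ℝ × EuclideanSpace ℝ (Fin 3)} (hz₀ : z₀ ∈ W)
    (hnd1 : fderiv ℝ (v z₀.1) z₀.2 (EuclideanSpace.single 0 1) 2 ≠ 0 ∨
      fderiv ℝ (v z₀.1) z₀.2 (EuclideanSpace.single 1 1) 2 ≠ 0)
    (hnd2 : fderiv ℝ (v z₀.1) z₀.2 (EuclideanSpace.single 2 1) 0 ≠ 0 ∨
      fderiv ℝ (v z₀.1) z₀.2 (EuclideanSpace.single 2 1) 1 ≠ 0)
    (hsemi : ∀ y : EuclideanSpace ℝ (Fin 3),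
      0 ≤ fderiv ℝ (v z₀.1) y (EuclideanSpace.single 2 1) 0 * fderiv ℝ (v z₀.1) y (EuclideanSpace.single 0 1) 2 +
        fderiv ℝ (v z₀.1) y (EuclideanSpace.single 2 1) 1 * fderiv ℝ (v z₀.1) y (EuclideanSpace.single 1 1) 2) :
    False := by
  obtain ⟨s, y₀⟩ := z₀
  have hs : s < 0 := (hWs hz₀).1
  simp only at hnd1 hnd2 hsemi
  -- the slice and its vertical component
  have hu : ContDiff ℝ ∞ (v s) := contDiff_slice hrate hcont hmild hs
  have hu2 : ContDiff ℝ 2 (v s) := hu.of_le (by norm_cast)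
  have hu3 : ContDiff ℝ 3 (v s) := hu.of_le (by norm_cast)
  set g : EuclideanSpace ℝ (Fin 3) → ℝ := fun y' => v s y' 2 with hgdef
  have hg2 : ContDiff ℝ 2 g := contDiff_coord hu2 2
  have hg3 : ContDiff ℝ 3 g := contDiff_coord hu3 2
  have hgd : Differentiable ℝ g := hg2.differentiable (by norm_num)
  have hud : Differentiable ℝ (v s) := hu2.differentiable (by norm_num)
  -- `∂_b v₂ = D g e_b`
  have hcoord : ∀ y w, fderiv ℝ g y w = fderiv ℝ (v s) y w 2 := fun y w => fderiv_coord_apply (hud y) 2 w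
  -- the partial derivatives of `g`
  set G : Fin 3 → EuclideanSpace ℝ (Fin 3) → ℝ := fun b y => fderiv ℝ g y (EuclideanSpace.single b (1 : ℝ)) with hGdef
  have hG1 : ∀ b, ContDiff ℝ 1 (G b) := fun b => (hg2.fderiv_right (m := 1) (by norm_num)).clm_apply contDiff_const
  have hG2 : ∀ b, ContDiff ℝ 2 (G b) := fun b => (hg3.fderiv_right (m := 2) (by norm_num)).clm_apply contDiff_const
  have hGd : ∀ b, Differentiable ℝ (G b) := fun b => (hG1 b).differentiable one_ne_zero
  -- analyticity of `∂_b v₂`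
  have han : AnalyticOnNhd ℝ (v s) univ := analyticOnNhd_slice hcont (bdd_of_hasTypeITimeDecay hrate) hmild hs
  have hHan : ∀ b : Fin 3, AnalyticOnNhd ℝ (fun y => fderiv ℝ (v s) y (EuclideanSpace.single b (1 : ℝ)) 2) univ := by
    intro b y _
    have h1 : AnalyticAt ℝ (fderiv ℝ (v s)) y := (han y (mem_univ _)).fderiv
    have h2 : AnalyticAt ℝ (fun y => fderiv ℝ (v s) y (EuclideanSpace.single b (1 : ℝ))) y :=
      ((ContinuousLinearMap.apply ℝ (EuclideanSpace ℝ (Fin 3)) (EuclideanSpace.single b (1 : ℝ))).analyticAt _).comp h1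
    exact ((EuclideanSpace.proj (𝕜 := ℝ) (2 : Fin 3)).analyticAt _).comp h2
  -- the flat heights
  set F : Set ℝ := {c | ∀ y : EuclideanSpace ℝ (Fin 3), y 2 = c →
    fderiv ℝ (v s) y (EuclideanSpace.single 0 1) 2 = 0 ∧ fderiv ℝ (v s) y (EuclideanSpace.single 1 1) 2 = 0} with hFdef
  have hz₁F : y₀ 2 ∉ F := fun h => by
    rcases hnd1 with h1 | h1
    · exact h1 (h y₀ rfl).1
    · exact h1 (h y₀ rfl).2
  have hF : Dense Fᶜ := by
    rw [← interior_eq_empty_iff_dense_compl, eq_empty_iff_forall_notMem]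
    intro c hc
    obtain ⟨r, hr, hball⟩ := Metric.mem_nhds_iff.mp (mem_interior_iff_mem_nhds.mp hc)
    -- `∂_b v₂` vanishes on the open slab `{y | y₂ ∈ ball c r}`, hence everywhere
    have hzero : ∀ b : Fin 3, b = 0 ∨ b = 1 → ∀ y : EuclideanSpace ℝ (Fin 3),
        fderiv ℝ (v s) y (EuclideanSpace.single b (1 : ℝ)) 2 = 0 := by
      intro b hb
      have hslab : IsOpen {y : EuclideanSpace ℝ (Fin 3) | y 2 ∈ ball c r} :=
        isOpen_ball.preimage (EuclideanSpace.proj (𝕜 := ℝ) (2 : Fin 3)).continuous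
      set x₀ : EuclideanSpace ℝ (Fin 3) := c • EuclideanSpace.single 2 (1 : ℝ) with hx₀
      have hx₀2 : x₀ 2 = c := by simp [hx₀]
      have hev : (fun y => fderiv ℝ (v s) y (EuclideanSpace.single b (1 : ℝ)) 2) =ᶠ[𝓝 x₀] 0 := by
        filter_upwards [hslab.mem_nhds (show x₀ ∈ {y : EuclideanSpace ℝ (Fin 3) | y 2 ∈ ball c r} by
          simp only [mem_setOf_eq, hx₀2]; exact mem_ball_self hr)] with y hy
        have hyF := hball hy
        rcases hb with rfl | rfl
        · exact (hyF y rfl).1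
        · exact (hyF y rfl).2
      have := (hHan b).eqOn_zero_of_preconnected_of_eventuallyEq_zero isPreconnected_univ (mem_univ x₀) hev
      exact fun y => this (mem_univ y)
    rcases hnd1 with h1 | h1
    · exact h1 (hzero 0 (Or.inl rfl) y₀)
    · exact h1 (hzero 1 (Or.inr rfl) y₀)
  -- the slope at non-flat heights, with its sign and the slice identity
  have key : ∀ c, c ∉ F → ∃ μ : ℝ, 0 ≤ μ ∧
      (∀ y : EuclideanSpace ℝ (Fin 3), y 2 = c → ∀ b : Fin 3, b ≠ 2 →
        fderiv ℝ (v s) y (EuclideanSpace.single 2 1) b = μ * fderiv ℝ (v s) y (EuclideanSpace.single b 1) 2) ∧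
      ∀ x : EuclideanSpace ℝ (Fin 3), x 2 = c →
        fderiv ℝ (G 2) x (EuclideanSpace.single 2 (1 : ℝ)) =
          -μ * (fderiv ℝ (G 0) x (EuclideanSpace.single 0 (1 : ℝ)) + fderiv ℝ (G 1) x (EuclideanSpace.single 1 (1 : ℝ))) := by
    intro c hc
    rcases linearSlice_of_timeHeightShear hrate hcont hmild hdiv hW hWne hWs hTH s hs c with hflat | ⟨μ, hμ, hwave⟩
    · exact absurd hflat hc
    refine ⟨μ, ?_, hμ, fun x hx => hwave x hx⟩
    -- sign: at a non-flat point of the plane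
    simp only [hFdef, mem_setOf_eq, not_forall, not_and_or] at hc
    obtain ⟨y, hy, hy'⟩ := hc
    have h0 := hμ y hy 0 (by decide)
    have h1 := hμ y hy 1 (by decide)
    have hsy := hsemi y
    rw [h0, h1] at hsy
    have hpos : 0 < fderiv ℝ (v s) y (EuclideanSpace.single 0 1) 2 ^ 2 + fderiv ℝ (v s) y (EuclideanSpace.single 1 1) 2 ^ 2 := by
      rcases hy' with h | h
      · exact add_pos_of_pos_of_nonneg (sq_pos_iff.mpr h) (sq_nonneg _)
      · exact add_pos_of_nonneg_of_pos (sq_nonneg _) (sq_pos_iff.mpr h)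
    by_contra hneg
    push Not at hneg
    nlinarith
  -- the slope function
  classical
  obtain ⟨Λ, hΛF, hΛT⟩ : ∃ Λ : ℝ → ℝ, (∀ c (hc : c ∉ F), Λ c = Classical.choose (key c hc)) ∧ ∀ c ∈ F, Λ c = 0 :=
    ⟨fun c => if hc : c ∈ F then 0 else Classical.choose (key c hc), fun c hc => dif_neg hc, fun c hc => dif_pos hc⟩
  have hΛ0 : ∀ c, 0 ≤ Λ c := by
    intro c
    by_cases hc : c ∈ F
    · rw [hΛT c hc]
    · rw [hΛF c hc]; exact (Classical.choose_spec (key c hc)).1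
  -- `Λ > 0` at the height of `z₀`
  have hΛ₁ : 0 < Λ (y₀ 2) := by
    rw [hΛF _ hz₁F]
    obtain ⟨hμ0, hμ, -⟩ := Classical.choose_spec (key _ hz₁F)
    set μ := Classical.choose (key _ hz₁F)
    rcases hμ0.lt_or_eq with h | h
    · exact h
    · exfalso
      have h0 := hμ y₀ rfl 0 (by decide)
      have h1 := hμ y₀ rfl 1 (by decide)
      rw [← h, zero_mul] at h0 h1
      rcases hnd2 with h2 | h2
      · exact h2 h0
      · exact h2 h1
  -- class bounds on `g` and its derivatives
  obtain ⟨K0, -, hK0⟩ := exists_iteratedFDeriv_rate_of_class 0 hrate hcont hmild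
  obtain ⟨K1, -, hK1⟩ := exists_iteratedFDeriv_rate_of_class 1 hrate hcont hmild
  obtain ⟨K2, -, hK2⟩ := exists_iteratedFDeriv_rate_of_class 2 hrate hcont hmild
  set B0 : ℝ := K0 / Real.sqrt (-s) ^ (0 + 1)
  set B1 : ℝ := K1 / Real.sqrt (-s) ^ (1 + 1)
  set B2 : ℝ := K2 / Real.sqrt (-s) ^ (2 + 1)
  have hgB0 : ∀ y, ‖g y‖ ≤ B0 := fun y => by
    have := (norm_iteratedFDeriv_coord_le hu2 2 (k := 0) (by norm_num) y).trans (hK0 s hs y)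
    rwa [norm_iteratedFDeriv_zero] at this
  have hgB1 : ∀ y, ‖fderiv ℝ g y‖ ≤ B1 := fun y => by
    have := (norm_iteratedFDeriv_coord_le hu2 2 (k := 1) (by norm_num) y).trans (hK1 s hs y)
    rwa [norm_iteratedFDeriv_one] at this
  have hgB2' : ∀ y, ‖iteratedFDeriv ℝ 2 g y‖ ≤ B2 := fun y =>
    (norm_iteratedFDeriv_coord_le hu2 2 (k := 2) (by norm_num) y).trans (hK2 s hs y)
  have hgB2 : ∀ y, ‖fderiv ℝ (fderiv ℝ g) y‖ ≤ B2 := fun y => by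
    have := hgB2' y
    rwa [← norm_iteratedFDeriv_fderiv, norm_iteratedFDeriv_one] at this
  have hB0 : 0 ≤ B0 := (norm_nonneg (g y₀)).trans (hgB0 y₀)
  have hB1 : 0 ≤ B1 := (norm_nonneg (fderiv ℝ g y₀)).trans (hgB1 y₀)
  have hB2 : 0 ≤ B2 := (norm_nonneg (fderiv ℝ (fderiv ℝ g) y₀)).trans (hgB2 y₀)
  set M : ℝ := B0 + B1 + 2 * B2 with hM
  -- the family for Theorem A
  set w : ℝ → EuclideanSpace ℝ (Fin 3) → ℝ := fun z => sliceFun g z with hw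
  set wz : ℝ → EuclideanSpace ℝ (Fin 3) → ℝ := fun z => sliceFun (G 2) z with hwz
  set wzz : ℝ → EuclideanSpace ℝ (Fin 3) → ℝ :=
    fun z => sliceFun (fun x => fderiv ℝ (G 2) x (EuclideanSpace.single 2 (1 : ℝ))) z with hwzz
  have hw2 : ∀ z, ContDiff ℝ 2 (w z) := fun z => contDiff_sliceFun hg2 z
  -- bounds
  have hb0 : ∀ z x, ‖w z x‖ ≤ M := fun z x => (hgB0 _).trans (by linarith)
  have hb1 : ∀ z x, ‖fderiv ℝ (w z) x‖ ≤ M := fun z x => by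
    have := norm_iteratedFDeriv_sliceFun_le hg2 z x (k := 1) (by norm_num)
    rw [norm_iteratedFDeriv_one, norm_iteratedFDeriv_one] at this
    exact this.trans ((hgB1 _).trans (by linarith))
  have hb2' : ∀ z x, ‖fderiv ℝ (fderiv ℝ (w z)) x‖ ≤ B2 := fun z x => by
    have := norm_iteratedFDeriv_sliceFun_le hg2 z x (k := 2) (by norm_num)
    rw [← norm_iteratedFDeriv_fderiv, norm_iteratedFDeriv_one] at this
    exact this.trans (hgB2' _)
  have hb2 : ∀ z x, ‖fderiv ℝ (fderiv ℝ (w z)) x‖ ≤ M := fun z x => (hb2' z x).trans (by linarith)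
  have hg0 : ∀ z x, ‖gradient (w z) x‖ ≤ M := fun z x => by
    rw [norm_gradient_eq_norm_fderiv_real]; exact hb1 z x
  have hgradD : ∀ z x, HasFDerivAt (gradient (w z))
      (((InnerProductSpace.toDual ℝ (EuclideanSpace ℝ (Fin 3))).symm.toContinuousLinearEquiv :
        (EuclideanSpace ℝ (Fin 3) →L[ℝ] ℝ) →L[ℝ] EuclideanSpace ℝ (Fin 3)).comp (fderiv ℝ (fderiv ℝ (w z)) x)) x := by
    intro z x
    have hd : DifferentiableAt ℝ (fderiv ℝ (w z)) x :=
      ((hw2 z).fderiv_right (m := 1) (by norm_num)).differentiable one_ne_zero x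
    exact ((InnerProductSpace.toDual ℝ (EuclideanSpace ℝ (Fin 3))).symm.toContinuousLinearEquiv.hasFDerivAt).comp x
      hd.hasFDerivAt
  have hg1 : ∀ z x, ‖fderiv ℝ (gradient (w z)) x‖ ≤ M := fun z x => by
    rw [(hgradD z x).fderiv]
    refine (ContinuousLinearMap.opNorm_le_bound _ (norm_nonneg (fderiv ℝ (fderiv ℝ (w z)) x)) fun y => ?_).trans
      (hb2 z x)
    rw [ContinuousLinearMap.comp_apply, ContinuousLinearEquiv.coe_coe, LinearIsometryEquiv.coe_toContinuousLinearEquiv,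
      LinearIsometryEquiv.norm_map]
    exact ContinuousLinearMap.le_opNorm _ _
  -- the horizontal Laplacian and its bound
  have hlap : ∀ z x, VectorCalculus.divergence (gradient (w z)) x =
      fderiv ℝ (G 0) (hlift z x) (EuclideanSpace.single 0 (1 : ℝ)) + fderiv ℝ (G 1) (hlift z x) (EuclideanSpace.single 1 (1 : ℝ)) :=
    fun z x => divergence_gradient_sliceFun hg2 z x
  have hGb : ∀ a a' x, |fderiv ℝ (G a) x (EuclideanSpace.single a' (1 : ℝ))| ≤ B2 := fun a a' x =>
    (abs_fderiv_fderiv_apply_le hg2 x a a').trans (hgB2 x)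
  have hdivb : ∀ z x, |VectorCalculus.divergence (gradient (w z)) x| ≤ M := fun z x => by
    rw [hlap]
    refine (abs_add_le _ _).trans ?_
    linarith [hGb 0 0 (hlift z x), hGb 1 1 (hlift z x)]
  -- continuity
  have hhl : ∀ z, Continuous (hlift z) := fun z => hproj.continuous.add continuous_const
  have hwzc : ∀ z, Continuous (wz z) := fun z => (hG1 2).continuous.comp (hhl z)
  have hG2' : Continuous fun x => fderiv ℝ (G 2) x (EuclideanSpace.single 2 (1 : ℝ)) :=
    ((hG1 2).continuous_fderiv one_ne_zero).clm_apply continuous_const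
  have hwzzc : ∀ z, Continuous (wzz z) := fun z => hG2'.comp (hhl z)
  have hwzzcz : ∀ x, Continuous fun z => wzz z x := fun x =>
    hG2'.comp (continuous_const.add (continuous_id.smul continuous_const))
  have hbz : ∀ z x, |wz z x| ≤ M := fun z x => by
    show |fderiv ℝ g (hlift z x) (EuclideanSpace.single 2 (1 : ℝ))| ≤ M
    rw [← Real.norm_eq_abs]
    refine (ContinuousLinearMap.le_opNorm _ _).trans ?_
    rw [show ‖(EuclideanSpace.single 2 (1 : ℝ) : EuclideanSpace ℝ (Fin 3))‖ = 1 by simp, mul_one]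
    exact (hgB1 _).trans (by linarith)
  have hbzz : ∀ z x, |wzz z x| ≤ M := fun z x => (hGb 2 2 (hlift z x)).trans (by linarith)
  -- height derivatives
  have hd1 : ∀ x z, HasDerivAt (fun s' => w s' x) (wz z x) z := fun x z => hasDerivAt_sliceFun_height hgd x z
  have hd2 : ∀ x z, HasDerivAt (fun s' => wz s' x) (wzz z x) z := fun x z => hasDerivAt_sliceFun_height (hGd 2) x z
  -- the slice equation off the flat heights
  have heq : ∀ z, z ∉ F → ∀ x, wzz z x = -(Λ z) * VectorCalculus.divergence (gradient (w z)) x := by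
    intro z hz x
    rw [hlap, hΛF z hz]
    exact (Classical.choose_spec (key z hz)).2.2 (hlift z x) (hlift_apply_two z x)
  -- THEOREM A
  have hA := fderiv_eq_zero_of_sliceEquation (E := EuclideanSpace ℝ (Fin 3)) (by simp) w wz wzz Λ F hw2 hb0 hb1 hb2
    hg0 hg1 hdivb hwzc hwzzc hwzzcz hbz hbzz hd1 hd2 hF hΛ0 hz₁F hΛ₁ heq
  -- conclusion at `z₀`
  have hfin : ∀ b : Fin 3, b ≠ 2 → fderiv ℝ (v s) y₀ (EuclideanSpace.single b (1 : ℝ)) 2 = 0 := by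
    intro b hb
    have h : fderiv ℝ (w (y₀ 2)) y₀ (EuclideanSpace.single b (1 : ℝ)) = 0 := by rw [hA (y₀ 2) y₀]; rfl
    rwa [show w (y₀ 2) = sliceFun g (y₀ 2) from rfl, fderiv_sliceFun_apply hgd, hproj_single_of_ne hb,
      hlift_of_eq rfl, hcoord] at h
  rcases hnd1 with h1 | h1
  · exact h1 (hfin 0 (by decide))
  · exact h1 (hfin 1 (by decide))

/-- **`stub_semiElliptic` ∩ (TH).**  The `mixed_type` stub `stub_semiElliptic` (crux `PoloidalWindowRigidity`, skeleton
`Lines/mixed_type.lean` v1) WITH the extra hypothesis that the shear slope is a function of time and height on the window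
(the stratum (TH)), everything else verbatim: such a profile is not singular — indeed the hypotheses are contradictory
(`not_timeHeightShear_semiElliptic`; the pin, the twist and poloidality are not even used). [folklore] -/
theorem stub_semiElliptic_of_TH (C : ℝ) (v : ℝ → EuclideanSpace ℝ (Fin 3) → EuclideanSpace ℝ (Fin 3))
    (hrate : Literature.Analysis.FluidPDE.HasTypeITimeDecay C v)
    (hcont : ContinuousOn (Function.uncurry v) (Set.Iio (0 : ℝ) ×ˢ Set.univ))
    (hmild : ∀ s t : ℝ, s < t → t < 0 → ∀ x, v t x =
      Literature.Analysis.UnboundedOperators.heatExtension (v s) (t - s) x -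
        Literature.Analysis.FluidPDE.oseenDuhamel 1 s v v t x)
    (hdiv : ∀ t < 0, Literature.Analysis.FluidPDE.VectorCalculus.IsDivFree (v t))
    (_hpol : ∀ s < 0, ∀ y, ⟪Literature.Analysis.FluidPDE.curl (v s) y, EuclideanSpace.single 2 1⟫_ℝ = 0)
    (W : Set (ℝ × EuclideanSpace ℝ (Fin 3))) (hW : IsOpen W) (hWne : W.Nonempty) (hWs : W ⊆ Set.Iio (0 : ℝ) ×ˢ Set.univ)
    (hTH : ∃ m : ℝ → ℝ → ℝ, ∀ z ∈ W, ∀ b : Fin 3, b ≠ 2 →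
      fderiv ℝ (v z.1) z.2 (EuclideanSpace.single 2 1) b =
        m z.1 (z.2 2) * fderiv ℝ (v z.1) z.2 (EuclideanSpace.single b 1) 2)
    (hnd : ∀ z ∈ W, Literature.Analysis.FluidPDE.curl (v z.1) z.2 ≠ 0 ∧
      (fderiv ℝ (v z.1) z.2 (EuclideanSpace.single 0 1) 2 ≠ 0 ∨ fderiv ℝ (v z.1) z.2 (EuclideanSpace.single 1 1) 2 ≠ 0) ∧
      (fderiv ℝ (v z.1) z.2 (EuclideanSpace.single 2 1) 0 ≠ 0 ∨ fderiv ℝ (v z.1) z.2 (EuclideanSpace.single 2 1) 1 ≠ 0))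
    (_hpin : ∀ m : ℝ → ℝ, ∀ W₁ : Set (ℝ × EuclideanSpace ℝ (Fin 3)), W₁ ⊆ W → IsOpen W₁ → W₁.Nonempty →
      ∃ z ∈ W₁, ∃ b : Fin 3, b ≠ 2 ∧
        fderiv ℝ (v z.1) z.2 (EuclideanSpace.single 2 1) b ≠
          m z.1 * fderiv ℝ (v z.1) z.2 (EuclideanSpace.single b 1) 2)
    (_htwist : ∀ z ∈ W,
      fderiv ℝ (fun x => fderiv ℝ (v z.1) x (EuclideanSpace.single 2 1) 2) z.2 (EuclideanSpace.single 0 1) *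
          fderiv ℝ (v z.1) z.2 (EuclideanSpace.single 1 1) 2 -
        fderiv ℝ (fun x => fderiv ℝ (v z.1) x (EuclideanSpace.single 2 1) 2) z.2 (EuclideanSpace.single 1 1) *
          fderiv ℝ (v z.1) z.2 (EuclideanSpace.single 0 1) 2 ≠ 0)
    (a b : ℝ) (hWab : W ⊆ Set.Ioo a b ×ˢ Set.univ)
    (hsemi : ∀ s ∈ Set.Ioo a b, ∀ y : EuclideanSpace ℝ (Fin 3),
      0 ≤ fderiv ℝ (v s) y (EuclideanSpace.single 2 1) 0 * fderiv ℝ (v s) y (EuclideanSpace.single 0 1) 2 +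
        fderiv ℝ (v s) y (EuclideanSpace.single 2 1) 1 * fderiv ℝ (v s) y (EuclideanSpace.single 1 1) 2) :
    ¬ Literature.Analysis.FluidPDE.IsBackwardSingularPoint v 0 := by
  intro _
  obtain ⟨z₀, hz₀⟩ := hWne
  obtain ⟨m, hm⟩ := hTH
  obtain ⟨-, hnd1, hnd2⟩ := hnd z₀ hz₀
  exact not_timeHeightShear_semiElliptic hrate hcont hmild hdiv hW ⟨z₀, hz₀⟩ hWs hm hz₀ hnd1 hnd2
    (hsemi z₀.1 (hWab hz₀).1)

/-- **Every slice through a class (TH) window is HYPERBOLIC somewhere.**  Class profile, (TH) on a nonempty open `W` in the slab,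
a point `z₀ ∈ W` with `∇ₕv₂(z₀) ≠ 0` and `∂₂vₕ(z₀) ≠ 0` ⇒ the slice `t = z₀.1` carries a point `y` with
`∂₂v₀·∂₀v₂ + ∂₂v₁·∂₁v₂ < 0` (negative type scalar) — the contrapositive of `not_timeHeightShear_semiElliptic`; the input of the
`mixed_type` relocation lemma `twisting_of_mixedType`. [folklore] -/
theorem exists_hyperbolic_point_of_TH (hrate : HasTypeITimeDecay C v)
    (hcont : ContinuousOn (uncurry v) (Iio (0 : ℝ) ×ˢ univ))
    (hmild : ∀ s t : ℝ, s < t → t < 0 → ∀ x,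
      v t x = UnboundedOperators.heatExtension (v s) (t - s) x - oseenDuhamel 1 s v v t x)
    (hdiv : ∀ t < 0, VectorCalculus.IsDivFree (v t))
    {W : Set (ℝ × EuclideanSpace ℝ (Fin 3))} (hW : IsOpen W) (hWne : W.Nonempty) (hWs : W ⊆ Iio (0 : ℝ) ×ˢ univ)
    {m : ℝ → ℝ → ℝ}
    (hTH : ∀ z ∈ W, ∀ b : Fin 3, b ≠ 2 →
      fderiv ℝ (v z.1) z.2 (EuclideanSpace.single 2 1) b =
        m z.1 (z.2 2) * fderiv ℝ (v z.1) z.2 (EuclideanSpace.single b 1) 2)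
    {z₀ : ℝ × EuclideanSpace ℝ (Fin 3)} (hz₀ : z₀ ∈ W)
    (hnd1 : fderiv ℝ (v z₀.1) z₀.2 (EuclideanSpace.single 0 1) 2 ≠ 0 ∨
      fderiv ℝ (v z₀.1) z₀.2 (EuclideanSpace.single 1 1) 2 ≠ 0)
    (hnd2 : fderiv ℝ (v z₀.1) z₀.2 (EuclideanSpace.single 2 1) 0 ≠ 0 ∨
      fderiv ℝ (v z₀.1) z₀.2 (EuclideanSpace.single 2 1) 1 ≠ 0) :
    ∃ y : EuclideanSpace ℝ (Fin 3),
      fderiv ℝ (v z₀.1) y (EuclideanSpace.single 2 1) 0 * fderiv ℝ (v z₀.1) y (EuclideanSpace.single 0 1) 2 +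
        fderiv ℝ (v z₀.1) y (EuclideanSpace.single 2 1) 1 * fderiv ℝ (v z₀.1) y (EuclideanSpace.single 1 1) 2 < 0 := by
  by_contra h
  push Not at h
  exact not_timeHeightShear_semiElliptic hrate hcont hmild hdiv hW hWne hWs hTH hz₀ hnd1 hnd2 h

end Summit.NavierStokesRegularity.NavierStokesRegularity.Theorems.PoloidalWindowDoorPoloidalWindowRigidityThmAClass

end
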